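import Summits.NavierStokesRegularity.NavierStokesRegularity.Theorems.ExtremiserTransienceNearExtremalTransienceExtremiserLiouvilleConstantSpeedJetBarycentre
import Literature.Analysis.FluidPDE.TaoEnstrophyLocalisationProofs
import HarnessLib

/-!
# Crux `ExtremiserTransience.NearExtremalTransience` (stmt-NavierStokesRegularity-21883), line `extremiser_liouville`,
# stub K1b — THE TEST FAMILY `Ψ_φ = ∇(∂₂φ) − (Δφ)e₂` AND THE LAW `⟪Ψ_φ(0), b⟫ = 0` FOR THE RESIDUE JET

`--supports stmt-NavierStokesRegularity-21883` (helper).  Author: prover seat `ns-el-k1b` (g5).  Continues `…ConstantSpeedJetBarycentre`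
(`⟪Ψ(0), ∫v dμ⟫ = 0` for every solenoidal `Ψ` whose Laplacian is horizontally a gradient).

Scalar calculus on `ℝ³` (`φ ∈ C^∞`): `fderiv_fderiv_apply_comm` (`∂_a∂_b = ∂_b∂_a`), `laplacian_fderiv_apply_comm` (`Δ∂_w = ∂_wΔ`).
THE TEST FAMILY, in components, `Ψ_φ = (∂₀∂₂φ)e₀ + (∂₁∂₂φ)e₁ + (∂₂∂₂φ − Δφ)e₂` (`= ∇(∂₂φ) − (Δφ)e₂ = curl curl(φe₂)`):
* smooth, compactly supported when `φ` is, DIVERGENCE FREE (`div Ψ_φ = Δ∂₂φ − ∂₂Δφ = 0`);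
* **`(ΔΨ_φ)ᵢ = ∂ᵢ g` with `g = Δ∂₂φ`** for the horizontal components `i = 0, 1`;
* hence (`inner_testField_barycentre_eq_zero`) **`⟪Ψ_φ(0), ∫ v dμ⟫ = 0` for every `φ ∈ C_c^∞`** for the residue JET (axial
  frame) with its multiplier `μ`.  Since `Ψ_φ(0) = (∂₀∂₂φ, ∂₁∂₂φ, −∂₀²φ − ∂₁²φ)(0)` ranges over `ℝ³` as `φ` varies
  (`φ = x₀x₂·bump, x₁x₂·bump, −(x₀²/2)·bump`), this says **`b = ∫ v dμ = 0`: the multiplier of a residue JET has zero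
  barycentre**, so (g3's `…MultiplierIdentities`) `μ(ℝ³) = κ⋆²ZW` exactly, `∫⟪v, c⟫dμ = 0`, and the Stokeslet law degenerates to
  `κ⋆²M²W·ΔV_R → 0` (the three explicit bumps are left to the next seat; the law is stated for all `φ`).

WHAT THIS IS NOT: K1b is NOT proved; nothing here proves NS regularity. [folklore]
-/

noncomputable section

open Set Filter Topology MeasureTheory Metric Function
open scoped ENNReal NNReal Topology InnerProductSpace RealInnerProductSpace ContDiff Laplacian
open Literature.Analysis.FluidPDE Literature.Analysis

namespace Summit.NavierStokesRegularity.NavierStokesRegularity.Theorems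

-- the problem directory repeats the summit name (`NavierStokesRegularity/NavierStokesRegularity`)
set_option linter.dupNamespace false

namespace ExtremiserLiouville

open DepletionLadder.KStar DepletionLadder.KStar.HalfSpace

variable {v : E3 → E3} {c : E3} {f φ : E3 → ℝ}

/-! ## Scalar calculus: commuting derivatives -/

/-- A directional derivative of a smooth scalar is smooth. [folklore] -/
theorem contDiff_fderiv_apply_const (hf : ContDiff ℝ ∞ f) (w : E3) : ContDiff ℝ ∞ fun z => fderiv ℝ f z w :=
  (hf.fderiv_right (m := ∞) (by norm_cast)).clm_apply contDiff_const

/-- A directional derivative of a compactly supported function is compactly supported. [folklore] -/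
theorem hasCompactSupport_fderiv_apply_const (hfc : HasCompactSupport f) (w : E3) :
    HasCompactSupport fun z => fderiv ℝ f z w :=
  (hfc.fderiv (𝕜 := ℝ)).comp_left (g := fun L : E3 →L[ℝ] ℝ => L w) rfl

/-- `∂_a ∂_b f = ∂_b ∂_a f` for `f ∈ C²`. [folklore] -/
theorem fderiv_fderiv_apply_comm (hf : ContDiff ℝ 2 f) (y a b : E3) :
    fderiv ℝ (fun z => fderiv ℝ f z b) y a = fderiv ℝ (fun z => fderiv ℝ f z a) y b := by
  rw [fderiv_fderiv_apply_eq hf y b, fderiv_fderiv_apply_eq hf y a]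
  exact (hf.contDiffAt.isSymmSndFDerivAt (n := 2) (by simp)) b a

/-- `Δf = Σᵢ ∂ᵢ∂ᵢ f` as functions on `ℝ³` (`f ∈ C²`; Mathlib's Laplacian in the standard basis). [folklore] -/
theorem laplacian_eq_sum_fun (hf : ContDiff ℝ 2 f) :
    (fun z => (Δ f) z) = fun z => ∑ i : Fin 3,
      fderiv ℝ (fun u => fderiv ℝ f u (EuclideanSpace.basisFun (Fin 3) ℝ i)) z (EuclideanSpace.basisFun (Fin 3) ℝ i) := by
  funext z
  rw [InnerProductSpace.laplacian_eq_iteratedFDeriv_orthonormalBasis f (EuclideanSpace.basisFun (Fin 3) ℝ)]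
  refine Finset.sum_congr rfl fun i _ => ?_
  rw [iteratedFDeriv_two_apply, fderiv_fderiv_apply_eq hf z (EuclideanSpace.basisFun (Fin 3) ℝ i)]
  simp

/-- The Laplacian of a smooth scalar is smooth. [folklore] -/
theorem contDiff_laplacian_scalar_top (hf : ContDiff ℝ ∞ f) : ContDiff ℝ ∞ fun z => (Δ f) z := by
  rw [laplacian_eq_sum_fun (hf.of_le (by norm_cast))]
  exact ContDiff.sum fun i _ => contDiff_fderiv_apply_const (contDiff_fderiv_apply_const hf _) _

/-- **`Δ(∂_w f) = ∂_w(Δf)`** for smooth `f`. [folklore] -/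
theorem laplacian_fderiv_apply_comm (hf : ContDiff ℝ ∞ f) (y w : E3) :
    (Δ (fun z => fderiv ℝ f z w)) y = fderiv ℝ (fun z => (Δ f) z) y w := by
  have hfw : ContDiff ℝ ∞ (fun z => fderiv ℝ f z w) := contDiff_fderiv_apply_const hf w
  have h2 : ContDiff ℝ 2 f := hf.of_le (by norm_cast)
  have h2w : ContDiff ℝ 2 (fun z => fderiv ℝ f z w) := hfw.of_le (by norm_cast)
  rw [congrFun (laplacian_eq_sum_fun h2w) y, laplacian_eq_sum_fun h2]
  have hdi : ∀ i : Fin 3, Differentiable ℝ fun z =>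
      fderiv ℝ (fun u => fderiv ℝ f u (EuclideanSpace.basisFun (Fin 3) ℝ i)) z (EuclideanSpace.basisFun (Fin 3) ℝ i) :=
    fun i => (contDiff_fderiv_apply_const (contDiff_fderiv_apply_const hf _) _).differentiable (by simp)
  rw [fderiv_fun_sum fun i _ => (hdi i y), FunLike.coe_sum, Finset.sum_apply]
  refine Finset.sum_congr rfl fun i _ => ?_
  have hfi : ContDiff ℝ 2 (fun u => fderiv ℝ f u (EuclideanSpace.basisFun (Fin 3) ℝ i)) :=
    (contDiff_fderiv_apply_const hf _).of_le (by norm_cast)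
  have c1 : (fun z => fderiv ℝ (fun u => fderiv ℝ f u w) z (EuclideanSpace.basisFun (Fin 3) ℝ i)) =
      fun z => fderiv ℝ (fun u => fderiv ℝ f u (EuclideanSpace.basisFun (Fin 3) ℝ i)) z w :=
    funext fun z => fderiv_fderiv_apply_comm h2 z (EuclideanSpace.basisFun (Fin 3) ℝ i) w
  rw [c1]
  exact fderiv_fderiv_apply_comm hfi y (EuclideanSpace.basisFun (Fin 3) ℝ i) w

/-! ## The test family, in components: `Ψ_φ = (∂₀∂₂φ)e₀ + (∂₁∂₂φ)e₁ + (∂₂∂₂φ − Δφ)e₂` -/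

/-- The components of a field of the form `F₀e₀ + F₁e₁ + F₂e₂`. [folklore] -/
theorem comb_apply (F₀ F₁ F₂ : E3 → ℝ) (y : E3) (i : Fin 3) :
    (F₀ y • EuclideanSpace.single (0 : Fin 3) (1 : ℝ) + F₁ y • EuclideanSpace.single (1 : Fin 3) (1 : ℝ) +
      F₂ y • EuclideanSpace.single (2 : Fin 3) (1 : ℝ)) i = ![F₀ y, F₁ y, F₂ y] i := by
  fin_cases i <;> simp

/-- The derivative of `F₀e₀ + F₁e₁ + F₂e₂` in the direction `w`. [folklore] -/
theorem fderiv_comb_apply {F₀ F₁ F₂ : E3 → ℝ} (h₀ : Differentiable ℝ F₀) (h₁ : Differentiable ℝ F₁)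
    (h₂ : Differentiable ℝ F₂) (y w : E3) :
    fderiv ℝ (fun y => F₀ y • EuclideanSpace.single (0 : Fin 3) (1 : ℝ) + F₁ y • EuclideanSpace.single (1 : Fin 3) (1 : ℝ) +
      F₂ y • EuclideanSpace.single (2 : Fin 3) (1 : ℝ)) y w =
      fderiv ℝ F₀ y w • EuclideanSpace.single (0 : Fin 3) (1 : ℝ) + fderiv ℝ F₁ y w • EuclideanSpace.single (1 : Fin 3) (1 : ℝ) +
        fderiv ℝ F₂ y w • EuclideanSpace.single (2 : Fin 3) (1 : ℝ) := by
  have h : HasFDerivAt (fun y => F₀ y • EuclideanSpace.single (0 : Fin 3) (1 : ℝ) +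
      F₁ y • EuclideanSpace.single (1 : Fin 3) (1 : ℝ) + F₂ y • EuclideanSpace.single (2 : Fin 3) (1 : ℝ))
      ((fderiv ℝ F₀ y).smulRight (EuclideanSpace.single (0 : Fin 3) (1 : ℝ)) +
        (fderiv ℝ F₁ y).smulRight (EuclideanSpace.single (1 : Fin 3) (1 : ℝ)) +
        (fderiv ℝ F₂ y).smulRight (EuclideanSpace.single (2 : Fin 3) (1 : ℝ))) y :=
    (((h₀ y).hasFDerivAt.smul_const _).add ((h₁ y).hasFDerivAt.smul_const _)).add ((h₂ y).hasFDerivAt.smul_const _)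
  rw [h.fderiv]
  rfl

/-- The divergence of `F₀e₀ + F₁e₁ + F₂e₂` is `∂₀F₀ + ∂₁F₁ + ∂₂F₂`. [folklore] -/
theorem divergence_comb {F₀ F₁ F₂ : E3 → ℝ} (h₀ : Differentiable ℝ F₀) (h₁ : Differentiable ℝ F₁)
    (h₂ : Differentiable ℝ F₂) (y : E3) :
    VectorCalculus.divergence (fun y => F₀ y • EuclideanSpace.single (0 : Fin 3) (1 : ℝ) +
      F₁ y • EuclideanSpace.single (1 : Fin 3) (1 : ℝ) + F₂ y • EuclideanSpace.single (2 : Fin 3) (1 : ℝ)) y =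
      fderiv ℝ F₀ y (EuclideanSpace.single (0 : Fin 3) (1 : ℝ)) + fderiv ℝ F₁ y (EuclideanSpace.single (1 : Fin 3) (1 : ℝ)) +
        fderiv ℝ F₂ y (EuclideanSpace.single (2 : Fin 3) (1 : ℝ)) := by
  rw [divergence_eq_sum_inner_fderiv (EuclideanSpace.basisFun (Fin 3) ℝ), Fin.sum_univ_three]
  simp only [EuclideanSpace.basisFun_apply, fderiv_comb_apply h₀ h₁ h₂, inner_add_right, inner_smul_right,
    EuclideanSpace.inner_single_left]
  simp

/-! ## The law `⟪Ψ_φ(0), b⟫ = 0` -/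

/-- **`⟪Ψ_φ(0), ∫ v dμ⟫ = 0` for every `φ ∈ C_c^∞`**, for the residue JET in the axial frame with its multiplier `μ`
(hypotheses as in `inner_barycentre_eq_zero_of_horizontalGradient`), where
`Ψ_φ = (∂₀∂₂φ)e₀ + (∂₁∂₂φ)e₁ + (∂₂∂₂φ − Δφ)e₂ = ∇(∂₂φ) − (Δφ)e₂`. [folklore] -/
theorem inner_testField_barycentre_eq_zero (hv : ContDiff ℝ ∞ v) (hdiv : VectorCalculus.IsDivFree v) {M : ℝ}
    (hM : ∀ x, ‖v x‖ = M) (h1 : ∫⁻ x, ‖iteratedFDeriv ℝ 1 v x‖ₑ ^ 2 < ⊤) (h2 : ∫⁻ x, ‖iteratedFDeriv ℝ 2 v x‖ₑ ^ 2 < ⊤)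
    (μ : Measure E3) [IsFiniteMeasure μ]
    (hμ : ∀ ψ : E3 → E3, ContDiff ℝ ∞ ψ → HasCompactSupport ψ → VectorCalculus.IsDivFree ψ →
      Jst v * J1 v ψ - kStar ^ 2 * M ^ 2 * (Wpa v * A1 v ψ + Zen v * C1 v ψ) = ∫ x, ⟪v x, ψ x⟫_ℝ ∂μ)
    (hc0 : c 0 = 0) (hc1 : c 1 = 0) (hc2 : c 2 ≠ 0) (hcM : ‖c‖ = M)
    (hL2 : ∀ T : ℝ, Integrable (fun x => {x : E3 | |x 2| ≤ T}.indicator (fun x => ‖v x - c‖ ^ 2) x) volume)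
    {E₀ : ℝ} (hE : ∀ u ∈ Icc (0 : ℝ) 1, (∫ x : E3, deriv Real.smoothTransition (x 2 - u) * ‖v x - c‖ ^ 2) = E₀)
    (hφ : ContDiff ℝ ∞ φ) (hφc : HasCompactSupport φ) :
    ⟪(fderiv ℝ (fun z => fderiv ℝ φ z (EuclideanSpace.single (2 : Fin 3) (1 : ℝ))) 0 (EuclideanSpace.single (0 : Fin 3) (1 : ℝ))) •
        EuclideanSpace.single (0 : Fin 3) (1 : ℝ) +
      (fderiv ℝ (fun z => fderiv ℝ φ z (EuclideanSpace.single (2 : Fin 3) (1 : ℝ))) 0 (EuclideanSpace.single (1 : Fin 3) (1 : ℝ))) •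
        EuclideanSpace.single (1 : Fin 3) (1 : ℝ) +
      (fderiv ℝ (fun z => fderiv ℝ φ z (EuclideanSpace.single (2 : Fin 3) (1 : ℝ))) 0 (EuclideanSpace.single (2 : Fin 3) (1 : ℝ)) -
        (Δ φ) 0) • EuclideanSpace.single (2 : Fin 3) (1 : ℝ), ∫ x, v x ∂μ⟫_ℝ = 0 := by
  -- names: `e i`, the scalar `∂₂φ`, the coefficients
  set e0 : E3 := EuclideanSpace.single (0 : Fin 3) (1 : ℝ) with he0
  set e1 : E3 := EuclideanSpace.single (1 : Fin 3) (1 : ℝ) with he1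
  set e2 : E3 := EuclideanSpace.single (2 : Fin 3) (1 : ℝ) with he2
  set p : E3 → ℝ := fun z => fderiv ℝ φ z e2 with hp
  have hpC : ContDiff ℝ ∞ p := contDiff_fderiv_apply_const hφ e2
  have hpc : HasCompactSupport p := hasCompactSupport_fderiv_apply_const hφc e2
  set F₀ : E3 → ℝ := fun z => fderiv ℝ p z e0 with hF₀
  set F₁ : E3 → ℝ := fun z => fderiv ℝ p z e1 with hF₁
  set g : E3 → ℝ := fun z => (Δ p) z with hg
  set F₂ : E3 → ℝ := fun z => fderiv ℝ p z e2 - (Δ φ) z with hF₂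
  have hF₀C : ContDiff ℝ ∞ F₀ := contDiff_fderiv_apply_const hpC e0
  have hF₁C : ContDiff ℝ ∞ F₁ := contDiff_fderiv_apply_const hpC e1
  have hΔφC : ContDiff ℝ ∞ (fun z => (Δ φ) z) := contDiff_laplacian_scalar_top hφ
  have hF₂C : ContDiff ℝ ∞ F₂ := (contDiff_fderiv_apply_const hpC e2).sub hΔφC
  have hgC : ContDiff ℝ ∞ g := contDiff_laplacian_scalar_top hpC
  -- compact supports
  have hΔsupp : ∀ {q : E3 → ℝ}, ContDiff ℝ ∞ q → HasCompactSupport q → HasCompactSupport fun z => (Δ q) z := by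
    intro q hq hqc
    rw [laplacian_eq_sum_fun (hq.of_le (by norm_cast))]
    have : (fun z => ∑ i : Fin 3, fderiv ℝ (fun u => fderiv ℝ q u (EuclideanSpace.basisFun (Fin 3) ℝ i)) z
        (EuclideanSpace.basisFun (Fin 3) ℝ i)) = fun z =>
        fderiv ℝ (fun u => fderiv ℝ q u (EuclideanSpace.basisFun (Fin 3) ℝ 0)) z (EuclideanSpace.basisFun (Fin 3) ℝ 0) +
        fderiv ℝ (fun u => fderiv ℝ q u (EuclideanSpace.basisFun (Fin 3) ℝ 1)) z (EuclideanSpace.basisFun (Fin 3) ℝ 1) +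
        fderiv ℝ (fun u => fderiv ℝ q u (EuclideanSpace.basisFun (Fin 3) ℝ 2)) z (EuclideanSpace.basisFun (Fin 3) ℝ 2) := by
      funext z; rw [Fin.sum_univ_three]
    rw [this]
    exact ((hasCompactSupport_fderiv_apply_const (hasCompactSupport_fderiv_apply_const hqc _) _).add
      (hasCompactSupport_fderiv_apply_const (hasCompactSupport_fderiv_apply_const hqc _) _)).add
      (hasCompactSupport_fderiv_apply_const (hasCompactSupport_fderiv_apply_const hqc _) _)
  have hF₀c : HasCompactSupport F₀ := hasCompactSupport_fderiv_apply_const hpc e0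
  have hF₁c : HasCompactSupport F₁ := hasCompactSupport_fderiv_apply_const hpc e1
  have hF₂c : HasCompactSupport F₂ := (hasCompactSupport_fderiv_apply_const hpc e2).sub (hΔsupp hφ hφc)
  have hgc : HasCompactSupport g := hΔsupp hpC hpc
  -- the test field
  set Ψ : E3 → E3 := fun y => F₀ y • e0 + F₁ y • e1 + F₂ y • e2 with hΨ
  have hΨC : ContDiff ℝ ∞ Ψ := ((hF₀C.smul contDiff_const).add (hF₁C.smul contDiff_const)).add (hF₂C.smul contDiff_const)
  have hΨc : HasCompactSupport Ψ :=
    ((hF₀c.smul_right (f' := fun _ => e0)).add (hF₁c.smul_right (f' := fun _ => e1))).add (hF₂c.smul_right (f' := fun _ => e2))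
  -- divergence free: `div Ψ = Δ(∂₂φ) − ∂₂(Δφ) = 0`
  have hΨdiv : VectorCalculus.IsDivFree Ψ := by
    intro y
    rw [hΨ, divergence_comb (hF₀C.differentiable (by simp)) (hF₁C.differentiable (by simp)) (hF₂C.differentiable (by simp)) y]
    have hsum : (Δ p) y = fderiv ℝ F₀ y e0 + fderiv ℝ F₁ y e1 + fderiv ℝ (fun z => fderiv ℝ p z e2) y e2 := by
      rw [congrFun (laplacian_eq_sum_fun (hpC.of_le (by norm_cast))) y, Fin.sum_univ_three]
      simp only [EuclideanSpace.basisFun_apply]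
      rfl
    have hF₂d : fderiv ℝ F₂ y e2 = fderiv ℝ (fun z => fderiv ℝ p z e2) y e2 - fderiv ℝ (fun z => (Δ φ) z) y e2 := by
      rw [hF₂, fderiv_fun_sub ((contDiff_fderiv_apply_const hpC e2).differentiable (by simp) y) (hΔφC.differentiable (by simp) y),
        FunLike.coe_sub, Pi.sub_apply]
    rw [hF₂d, ← laplacian_fderiv_apply_comm hφ y e2]
    show fderiv ℝ F₀ y e0 + fderiv ℝ F₁ y e1 + (fderiv ℝ (fun z => fderiv ℝ p z e2) y e2 - (Δ p) y) = 0
    rw [hsum]; ring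
  -- horizontal components of `ΔΨ` are `∂ᵢ g`, `g = Δ(∂₂φ)`
  have hcomp : ∀ (i : Fin 3), (fun z => Ψ z i) = ![F₀, F₁, F₂] i := by
    intro i; funext z
    show (F₀ z • e0 + F₁ z • e1 + F₂ z • e2) i = _
    rw [he0, he1, he2, comb_apply]
    fin_cases i <;> rfl
  have hhor : ∀ (y : E3) (i : Fin 3), i ≠ 2 → (Δ Ψ) y i = fderiv ℝ g y (EuclideanSpace.single i (1 : ℝ)) := by
    intro y i hi
    have hΨ2y : ContDiffAt ℝ 2 Ψ y := (hΨC.of_le (by norm_cast)).contDiffAt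
    have hci' := ContDiffAt.laplacian_CLM_comp_left (l := (EuclideanSpace.proj i : E3 →L[ℝ] ℝ)) hΨ2y
    have hci : (Δ (fun z => Ψ z i)) y = (Δ Ψ) y i := by
      have h' : (Δ (fun z => Ψ z i)) y = (EuclideanSpace.proj i : E3 →L[ℝ] ℝ) ((Δ Ψ) y) := hci'
      rw [h']; rfl
    rw [← hci, hcomp i]
    fin_cases i
    · show (Δ F₀) y = fderiv ℝ g y (EuclideanSpace.single 0 1)
      rw [hF₀, laplacian_fderiv_apply_comm hpC y e0]
    · show (Δ F₁) y = fderiv ℝ g y (EuclideanSpace.single 1 1)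
      rw [hF₁, laplacian_fderiv_apply_comm hpC y e1]
    · exact absurd rfl hi
  -- apply the barycentre law
  have h := inner_barycentre_eq_zero_of_horizontalGradient hv hdiv hM h1 h2 μ hμ hc0 hc1 hc2 hcM hL2 hE hΨC hΨc hΨdiv
    (hgC.of_le (by norm_cast)) hgc hhor
  simpa [hΨ, hF₀, hF₁, hF₂, hp] using h

end ExtremiserLiouville

end Summit.NavierStokesRegularity.NavierStokesRegularity.Theorems

end
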